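import Mathlib
import HarnessLib
import Literature.Analysis.PDE.DivFormStrongMaximumPrinciple
import Summits.NavierStokesRegularity.NavierStokesRegularity.Theorems.PoloidalWindowDoorPoloidalWindowRigidityDivFormLocalHarnack
import Summits.NavierStokesRegularity.NavierStokesRegularity.Theorems.PoloidalWindowDoorPoloidalWindowRigidityDivFormStrongMaximumPrincipleGlobalise
import Summits.NavierStokesRegularity.NavierStokesRegularity.Theorems.PoloidalWindowDoorPoloidalWindowRigidityDivFormStrongMaximumPrincipleDescent

/-!
# Route `PoloidalWindowDoor`, crux K2 (stmt-NavierStokesRegularity-19708) — DISCHARGE of the named fact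
# `Literature.Analysis.PDE.divFormStrongMaximumPrinciple` (Gilbarg–Trudinger 2001, Thm 8.19: the strong maximum principle
# for divergence-form equations with bounded measurable coefficients)

Assembly of the programme L1–L5 of cell pub/ns-inputs (seat ns-in-ser-b g5 with width from ns-in-ser-a g7):

* `smp_of_three_le` — the fact in dimension `n ≥ 3`.  Let `u ∈ C¹(Ω)` be a local weak solution attaining its supremum
  at `x₀ ∈ Ω`.  At a point `x₁ ∈ Ω` with `u x₁ = u x₀` pick `B̄(x₁,ρ) ⊆ Ω`; for `ε > 0` the function
  `v_ε = ε⁻¹(u x₀ − u) + 1 ≥ 1` is again a local weak solution on `Ω`, which `…Globalise.globalise_local_solution`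
  (ns-in-ser-a g7) turns into a pair `(aG, w)` satisfying the GLOBAL hypotheses of `…DivFormLocalHarnack.harnack_local` with
  `U = B(x₁,ρ)`; Harnack on `B̄(x₁,ρ/5)` against the point `x₁` (where `w = 1`) gives `u x₀ − u ≤ (C_H − 1)ε` there, so
  `u ≡ u x₀` near `x₁`: the coincidence set is open, and closed in `Ω` by continuity, hence all of the preconnected `Ω`.
* `_root_.Literature.Analysis.PDE.divFormStrongMaximumPrinciple_holds` — all dimensions: `n ≥ 3` as above, `n ≤ 2` by
  the descent `…Descent.smp_descent : P (n+1) → P n` (ns-in-ser-a g7; lift `u ∘ proj`), inducting downward as in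
  `…DivFormLiouvilleAll.liouville_all`.

The engine is the K2-p3 De Giorgi–Nash–Moser chain `…DivForm{Caccioppoli,…,Harnack}` (entire solutions), localised in
`…DivFormLocal{Caccioppoli,ReverseHolder,Moser,LogOsc,HarnackInputs,Harnack}` with the Bombieri–Giusti lemma
(`Literature.Analysis.FunctionSpaces.bombieriGiusti`) replacing the John–Nirenberg crossover.

WHAT THIS IS NOT: nothing here is specific to Navier–Stokes; no NS regularity statement is proved or touched — the fact is
an INPUT (consumer: line stub C1 `stub_ellipticThreadEmpty` of `Cruxes/PoloidalWindowRigidity/Lines/thread_type.lean`,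
which becomes unconditional as typed).  The general `W^{1,2}` subsolution form of GT 8.19 (lower-order terms,
non-symmetric `a`) is not addressed (the named fact renders the `C¹` / pure-principal-part case).
-/

noncomputable section

open MeasureTheory Set Function Filter Topology Metric Module
open scoped Matrix ENNReal NNReal

-- the summit and its single sub-problem share the name (CONVENTIONS §1), as in every Theorems file
set_option linter.dupNamespace false

namespace Summit.NavierStokesRegularity.NavierStokesRegularity.Theorems.PoloidalWindowDoorPoloidalWindowRigidityDivFormStrongMaximumPrinciple

open Summit.NavierStokesRegularity.NavierStokesRegularity.Theorems.PoloidalWindowDoorPoloidalWindowRigidityDivFormLocalHarnack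
open Summit.NavierStokesRegularity.NavierStokesRegularity.Theorems.PoloidalWindowDoorPoloidalWindowRigidityDivFormStrongMaximumPrincipleGlobalise
open Summit.NavierStokesRegularity.NavierStokesRegularity.Theorems.PoloidalWindowDoorPoloidalWindowRigidityDivFormStrongMaximumPrincipleDescent

variable {n : ℕ}

/-- **GT 8.19 for `C¹` local weak solutions, `n ≥ 3`**: for `Ω ⊆ ℝⁿ` open preconnected, `a` measurable with
symmetric, `λ`-elliptic, `Λ`-bounded values on `Ω`, and `u ∈ C¹(Ω)` with `∫ Σ aᵢⱼ ∂ᵢu ∂ⱼη = 0` for every `η ∈ C¹_c`,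
`tsupport η ⊆ Ω`: if `u` attains its supremum over `Ω` at `x₀ ∈ Ω` then `u ≡ u x₀` on `Ω`. -/
theorem smp_of_three_le (hn : 3 ≤ n) (Ω : Set (EuclideanSpace ℝ (Fin n))) (hΩ : IsOpen Ω) (hΩc : IsPreconnected Ω)
    (a : EuclideanSpace ℝ (Fin n) → Matrix (Fin n) (Fin n) ℝ) (lam Λ : ℝ) (hlam : 0 < lam)
    (hmeas : ∀ i j, Measurable fun y => a y i j) (hsymm : ∀ y ∈ Ω, (a y).IsSymm)
    (hell : ∀ y ∈ Ω, ∀ ξ : Fin n → ℝ, lam * (ξ ⬝ᵥ ξ) ≤ ξ ⬝ᵥ (a y *ᵥ ξ))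
    (hbd : ∀ y ∈ Ω, ∀ i j, |a y i j| ≤ Λ)
    (u : EuclideanSpace ℝ (Fin n) → ℝ) (hu : ContDiffOn ℝ 1 u Ω)
    (hweak : ∀ η : EuclideanSpace ℝ (Fin n) → ℝ, ContDiff ℝ 1 η → HasCompactSupport η → tsupport η ⊆ Ω →
      ∫ y, ∑ i, ∑ j, a y i j * fderiv ℝ u y (EuclideanSpace.single i 1) *
        fderiv ℝ η y (EuclideanSpace.single j 1) = 0)
    (x₀ : EuclideanSpace ℝ (Fin n)) (hx₀ : x₀ ∈ Ω) (hmax : ∀ y ∈ Ω, u y ≤ u x₀)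
    (y : EuclideanSpace ℝ (Fin n)) (hy : y ∈ Ω) : u y = u x₀ := by
  obtain ⟨C_H, hC0, hH⟩ := harnack_local hn hlam (max Λ lam)
  -- differentiability of `u` at points of the open set `Ω`
  have hdiff : ∀ z ∈ Ω, DifferentiableAt ℝ u z := fun z hz =>
    (hu.differentiableOn one_ne_zero z hz).differentiableAt (hΩ.mem_nhds hz)
  -- KEY: the coincidence set `{u = u x₀}` is open in `Ω`
  have key : ∀ x₁ ∈ Ω, u x₁ = u x₀ → ∃ r > 0, ball x₁ r ⊆ Ω ∧ ∀ z ∈ ball x₁ r, u z = u x₀ := by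
    intro x₁ hx₁ hux₁
    -- a closed ball inside `Ω`
    obtain ⟨ρ₀, hρ₀, hρ₀Ω⟩ := Metric.isOpen_iff.1 hΩ x₁ hx₁
    set ρ : ℝ := ρ₀ / 2 with hρ
    have hρpos : 0 < ρ := by positivity
    have hρΩ : closedBall x₁ ρ ⊆ Ω := (closedBall_subset_ball (by rw [hρ]; linarith)).trans hρ₀Ω
    set R : ℝ := ρ / 5 with hR
    have hRpos : 0 < R := by positivity
    have h4R : closedBall x₁ (4 * R) ⊆ ball x₁ ρ := closedBall_subset_ball (by rw [hR]; linarith)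
    have hRΩ : ball x₁ R ⊆ Ω :=
      (ball_subset_closedBall.trans (closedBall_subset_closedBall (by rw [hR]; linarith))).trans hρΩ
    refine ⟨R, hRpos, hRΩ, fun z hz => ?_⟩
    have hzΩ : z ∈ Ω := hRΩ hz
    -- for every `ε > 0`: `u x₀ − u z ≤ (C_H − 1) ε`
    have hε : ∀ ε : ℝ, 0 < ε → u x₀ - u z ≤ (C_H - 1) * ε := by
      intro ε hε
      set v : EuclideanSpace ℝ (Fin n) → ℝ := fun y => ε⁻¹ * (u x₀ - u y) + 1 with hv
      have hvC : ContDiffOn ℝ 1 v Ω := (contDiffOn_const.mul (contDiffOn_const.sub hu)).add contDiffOn_const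
      have hv1 : ∀ y ∈ Ω, 1 ≤ v y := fun y hy' => by
        have : 0 ≤ ε⁻¹ * (u x₀ - u y) := mul_nonneg (inv_nonneg.2 hε.le) (by linarith [hmax y hy'])
        rw [hv]; linarith
      -- `v` is again a local weak solution (linearity)
      have hdv : ∀ y ∈ Ω, ∀ e : EuclideanSpace ℝ (Fin n), fderiv ℝ v y e = -ε⁻¹ * fderiv ℝ u y e := by
        intro y hy' e
        have h := (((hdiff y hy').hasFDerivAt.const_sub (u x₀)).const_mul ε⁻¹).add_const (1 : ℝ)
        rw [show v = fun y => ε⁻¹ * (u x₀ - u y) + 1 from rfl, h.fderiv]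
        simp
      have hvweak : ∀ η : EuclideanSpace ℝ (Fin n) → ℝ, ContDiff ℝ 1 η → HasCompactSupport η → tsupport η ⊆ Ω →
          ∫ y, ∑ i, ∑ j, a y i j * fderiv ℝ v y (EuclideanSpace.single i 1) *
            fderiv ℝ η y (EuclideanSpace.single j 1) = 0 := by
        intro η hη hηc hηΩ
        have hpt : ∀ y, ∑ i, ∑ j, a y i j * fderiv ℝ v y (EuclideanSpace.single i 1) *
              fderiv ℝ η y (EuclideanSpace.single j 1) =
            (-ε⁻¹) * ∑ i, ∑ j, a y i j * fderiv ℝ u y (EuclideanSpace.single i 1) *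
              fderiv ℝ η y (EuclideanSpace.single j 1) := by
          intro y
          by_cases hy' : y ∈ Ω
          · simp only [hdv y hy', Finset.mul_sum]
            exact Finset.sum_congr rfl fun i _ => Finset.sum_congr rfl fun j _ => by ring
          · have hη0 : fderiv ℝ η y = 0 := fderiv_of_notMem_tsupport ℝ (fun h => hy' (hηΩ h))
            simp [hη0]
        simp_rw [hpt]
        rw [integral_const_mul, hweak η hη hηc hηΩ, mul_zero]
      -- globalise and apply Harnack on `B̄(x₁,R)` against the centre
      obtain ⟨aG, w, haGm, haGs, haGe, haGb, -, hwC, hw1, hwv, hwweak⟩ :=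
        globalise_local_solution hΩ hlam hmeas hsymm hell hbd hvC hv1 hvweak hρpos hρΩ
      have hHz := hH aG haGm haGs haGe haGb (ball x₁ ρ) w hwC hw1 hwweak x₁ R hRpos h4R z
        (ball_subset_closedBall hz) x₁ (mem_closedBall_self hRpos.le)
      have hzρ : z ∈ closedBall x₁ ρ := (ball_subset_closedBall.trans (closedBall_subset_closedBall
        (by rw [hR]; linarith))) hz
      rw [hwv z hzρ, hwv x₁ (mem_closedBall_self hρpos.le)] at hHz
      have hv₁ : v x₁ = 1 := by
        show ε⁻¹ * (u x₀ - u x₁) + 1 = 1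
        rw [hux₁, sub_self, mul_zero, zero_add]
      rw [hv₁, mul_one] at hHz
      -- `hHz : ε⁻¹ (u x₀ − u z) + 1 ≤ C_H`
      have h1 : ε⁻¹ * (u x₀ - u z) ≤ C_H - 1 := by
        have := hHz; simp only [hv] at this; linarith
      have h2 := mul_le_mul_of_nonneg_left h1 hε.le
      rwa [← mul_assoc, mul_inv_cancel₀ hε.ne', one_mul, mul_comm] at h2
    -- hence `u z = u x₀`
    have hge : 0 ≤ u x₀ - u z := by linarith [hmax z hzΩ]
    have hle : u x₀ - u z ≤ 0 := by
      refine le_of_forall_pos_le_add fun δ hδ => ?_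
      have h := hε (δ / (C_H + 1)) (by positivity)
      have h' : (C_H - 1) * (δ / (C_H + 1)) ≤ δ := by
        rw [mul_div_assoc', div_le_iff₀ (by positivity)]; nlinarith
      linarith
    linarith
  -- clopen argument in the preconnected `Ω`
  set Uo : Set (EuclideanSpace ℝ (Fin n)) := interior {x | u x = u x₀} with hUo
  set Vo : Set (EuclideanSpace ℝ (Fin n)) := Ω ∩ u ⁻¹' {t | t ≠ u x₀} with hVo
  have hUo_open : IsOpen Uo := isOpen_interior
  have hVo_open : IsOpen Vo := hu.continuousOn.isOpen_inter_preimage hΩ isOpen_ne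
  have hcover : Ω ⊆ Uo ∪ Vo := by
    intro x hx
    by_cases hux : u x = u x₀
    · obtain ⟨r, hr, -, hball⟩ := key x hx hux
      exact Or.inl (mem_interior.2 ⟨ball x r, fun z hz => hball z hz, isOpen_ball, mem_ball_self hr⟩)
    · exact Or.inr ⟨hx, hux⟩
  have hdisj : Disjoint Uo Vo := by
    rw [Set.disjoint_left]
    intro x hxU hxV
    have hx' : x ∈ {x | u x = u x₀} := interior_subset hxU
    exact hxV.2 hx'
  have hne : (Ω ∩ Uo).Nonempty := by
    obtain ⟨r, hr, -, hball⟩ := key x₀ hx₀ rfl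
    exact ⟨x₀, hx₀, mem_interior.2 ⟨ball x₀ r, fun z hz => hball z hz, isOpen_ball, mem_ball_self hr⟩⟩
  have hΩU : Ω ⊆ Uo := hΩc.subset_left_of_subset_union hUo_open hVo_open hdisj hcover hne
  have hyU : y ∈ {x | u x = u x₀} := interior_subset (hΩU hy)
  exact hyU

/-- **Discharge of the named fact `Literature.Analysis.PDE.divFormStrongMaximumPrinciple`** (Gilbarg–Trudinger 2001,
§8.7 Thm 8.19, in the tree's rendering: pure principal part, symmetric measurable uniformly elliptic bounded `a` on an
open preconnected `Ω ⊆ ℝⁿ`, `u ∈ C¹(Ω)` a weak solution against `C¹_c` tests supported in `Ω`, interior supremum ⇒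
constant).  `n ≥ 3`: `smp_of_three_le` (local De Giorgi–Nash–Moser / Bombieri–Giusti Harnack); `n ≤ 2`: descent from
`n + 1` (`…Descent.smp_descent`).  Cell pub/ns-inputs, seats ns-in-ser-b g5 (L1, L2, L3, L4, this file) and
ns-in-ser-a g7 (globalisation W2, descent W3), on the K2-p3 chain. -/
theorem _root_.Literature.Analysis.PDE.divFormStrongMaximumPrinciple_holds :
    Literature.Analysis.PDE.divFormStrongMaximumPrinciple := by
  intro n
  -- `P m`: the fact in dimension `m`
  let P : ℕ → Prop := fun m => ∀ (Ω : Set (EuclideanSpace ℝ (Fin m))), IsOpen Ω → IsPreconnected Ω →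
    ∀ (a : EuclideanSpace ℝ (Fin m) → Matrix (Fin m) (Fin m) ℝ) (lam Λ : ℝ), 0 < lam →
    (∀ i j, Measurable fun y => a y i j) → (∀ y ∈ Ω, (a y).IsSymm) →
    (∀ y ∈ Ω, ∀ ξ : Fin m → ℝ, lam * (ξ ⬝ᵥ ξ) ≤ ξ ⬝ᵥ (a y *ᵥ ξ)) →
    (∀ y ∈ Ω, ∀ i j, |a y i j| ≤ Λ) →
    ∀ (u : EuclideanSpace ℝ (Fin m) → ℝ), ContDiffOn ℝ 1 u Ω →
      (∀ η : EuclideanSpace ℝ (Fin m) → ℝ, ContDiff ℝ 1 η → HasCompactSupport η → tsupport η ⊆ Ω →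
        ∫ y, ∑ i, ∑ j, a y i j * fderiv ℝ u y (EuclideanSpace.single i 1) *
          fderiv ℝ η y (EuclideanSpace.single j 1) = 0) →
      ∀ x₀ ∈ Ω, (∀ y ∈ Ω, u y ≤ u x₀) → ∀ y ∈ Ω, u y = u x₀
  have hP : ∀ k m : ℕ, 3 ≤ m + k → P m := by
    intro k
    induction k with
    | zero => intro m hm; exact fun Ω hΩ hΩc a lam Λ hlam hmeas hsymm hell hbd u hu hweak x₀ hx₀ hmax y hy =>
        smp_of_three_le (by omega) Ω hΩ hΩc a lam Λ hlam hmeas hsymm hell hbd u hu hweak x₀ hx₀ hmax y hy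
    | succ k ih => intro m hm; exact fun Ω hΩ hΩc a lam Λ hlam hmeas hsymm hell hbd u hu hweak x₀ hx₀ hmax y hy =>
        smp_descent (ih (m + 1) (by omega)) Ω hΩ hΩc a lam Λ hlam hmeas hsymm hell hbd u hu hweak x₀ hx₀ hmax y hy
  intro Ω hΩ hΩc a lam Λ hlam hmeas hsymm hell hbd u hu hweak x₀ hx₀ hmax y hy
  exact hP 3 n (by omega) Ω hΩ hΩc a lam Λ hlam hmeas hsymm hell hbd u hu hweak x₀ hx₀ hmax y hy

end Summit.NavierStokesRegularity.NavierStokesRegularity.Theorems.PoloidalWindowDoorPoloidalWindowRigidityDivFormStrongMaximumPrinciple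

end
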